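import Literature.AnabelianGeometry.EtaleTheta.Discharge.Sec2AutKDotted
import Literature.AnabelianGeometry.EtaleTheta.Discharge.Sec2AutKHoldsXu
import HarnessLib

/-!
# [EtTh] Remark 2.6.1 (dotted curves) and Corollary 2.9 (all six members) WITHOUT Prop. 2.6 and WITHOUT
# temp-slimness: the dotted normalisers `N(Π^tp_Ż) = N(Π^tp_Z)` by `l` odd (proof-only)

S. Mochizuki, *The étale theta function and its Frobenioid-theoretic manifestations*, Publ. RIMS **45**
(2009) [EtTh], §2: Def. 2.5 (ii) p. 39, Rmk. 2.6.1 p. 40 («the 'Aut_K(−)'s' of the various once-dotted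
versions … are given by taking the direct product … with `Gal(Ċ^log/C^log) ≅ {±1}`»), Cor. 2.9 p. 43
(«for each of `Ẋ̲̲, Ċ̲, Ċ̲̲, X̲̲, C̲, C̲̲` … a bijection … `(ℤ/lℤ)^±`») [cite: MochizukiEtTh2009, Cor 2.9 p.43].
Cell abc-iut, layer L2, seat abc-iut-L2-t12 (gen 9), L2-lead row (w2) «COR29-SIX-COUNT WITHOUT PROP26»
(R848/R898). PROOF-ONLY (no definition, no instance, no `Prop`-valued fact); abc-iut-L2-t2's typed nodes
`TemperedCoverData.Rmk261_dotted` / `TemperedCoverData.Cor29_card` (`ThetaCoversTempered`) and the companions of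
abc-iut-L2-d3 (`Sec2AutKDotted`: `cor29_card_of`, `rmk261_dotted_of`, `normalizer_inf_PiCdot_eq`,
`nonempty_quotient_inf_mulEquiv_prod`, `not_le_PiCdot_of_mem_four`, index bookkeeping), abc-iut-L6-t23 / L2-d3
(`Sec2AutKHoldsXu`: `tpPiXu_normal`, `normalizer_tpPiCuu_eq`; `Sec2AutKHolds`: `normalizer_sup_eigen_eq`;
`Sec2CuspOrbits`: `natCard_cuspOrbits_of_normalizer_eq`; `ThetaCoversAutCu`: `normalizer_PiCu_eq`;
`Sec2AutKTransfer`: `normalizer_tp_eq_of_isOpen`; `Sec2Prop24Reduction`: `index_tp`) are consumed BY NAME.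

**The point.** In abc-iut-L2-d3's discharge of Cor. 2.9 / Rmk. 2.6.1 (dotted), [EtTh] Prop. 2.6 (FACT row F-0610,
`T.Prop26`) and temp-slimness (`IsSlimGroup Π^tp_C`) enter at exactly ONE place: `normalizer_inf_PiCdot_eq`,
the equality `N_{Π^tp_C}(Π^tp_Ż) = N_{Π^tp_C}(Π^tp_Z)` for the dotted members `Ż = Z ∩ Ċ`, `Z ∈ {X̲̲, X̲, C̲̲, C̲}`
(Rmk. 2.6.1 «by applying the Propositions 2.4, 2.6»). This file proves that equality by PURE GROUP THEORY
over the interface `TemperedCoverData` — no Prop. 2.6, no slimness — using only that `Π^tp_{X̲} ⊴ Π^tp_C`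
(`tpPiXu_normal`) and that `l` is ODD (field `l_odd`):
* `C̲`, `C̲̲`: `[Π^tp_C : Π^tp_{C̲}] = l` and `[Π^tp_C : Π^tp_{C̲̲}] = l²` are odd, so `Π^tp_Ż ⊄ Π^tp_X`
  (`Π^tp_X ∩ Π^tp_Ċ` has index `4`), whence `Π^tp_Ż ⊔ Π^tp_{X̲} = Π^tp_{C̲}` (`Π^tp_{X̲}` is maximal in
  `Π^tp_{C̲}`); an element normalising `Π^tp_Ż` therefore normalises `Π^tp_{C̲}`, i.e. lies in
  `N(Π^tp_{C̲}) = Π^tp_{C̲} = N(Π^tp_Z)` (Rmk. 2.1.1; `μ_l ⊆ K` for `C̲̲`);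
* `X̲̲`: an element `g` normalising `Π^tp_{Ẋ̲̲}` normalises `Π^tp_{X̲}`; `g Π^tp_{X̲̲} g⁻¹` is a subgroup of
  `Π^tp_{X̲}` of index `l` containing `Π^tp_{Ẋ̲̲}`, and `Π^tp_{X̲̲} ⊴ Π^tp_{X̲}` (`N(Π^tp_{X̲̲}) = Π^tp_{C̲}`,
  under `μ_l ⊆ K` and the printed definition `hΘ` of `Δ̄_Θ`), so `[g Π^tp_{X̲̲} g⁻¹ · Π^tp_{X̲̲} : Π^tp_{X̲̲}]`
  divides both `2` and `l` — it is `1`, `g ∈ N(Π^tp_{X̲̲})`;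
* `X̲`: `Π^tp_{X̲}` and `Π^tp_{Ẋ̲}` are both normal.
Hence **`rmk261_dotted_of_odd (hΘ) : T.Rmk261_dotted`** and **`cor29_card_of_odd (hΘ hC1 hC2) : T.Cor29_card`** —
abc-iut-L2-d3's closers `rmk261_dotted_of` / `cor29_card_of` with BOTH binders `h26 : T.Prop26` (F-0610) and
`hslim : IsSlimGroup T.Gtp` DELETED; the remaining hypotheses are theirs (printed definition `hΘ` of `Δ̄_Θ`,
cusp hypotheses `hC1`, `hC2`; `μ_l ⊆ K` sits inside the typed statements).

HONEST FRAMING: a statement about OUR typed one-object forms over the interface (the typed `Cor29_card` is the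
CARDINALITY form of Cor. 2.9; the label map itself is not typed); nothing of [EtTh] is asserted for genuine
tempered fundamental groups beyond what the kernel checks here; FACT row F-0610 is untouched as a label (it
is simply no longer a hypothesis of these two nodes' closers); no side is taken on [IUTchIII] Cor. 3.12;
typed ≠ proved elsewhere.
-/

namespace Literature.AnabelianGeometry.EtaleTheta

namespace ThetaCovers

universe u

/-! ## §1. Group theory: index `2` against odd index -/

section GroupTheory

variable {G : Type*} [Group G]

/-- Two DISTINCT subgroups of index `2` meet in a subgroup of index `4` (`[Π^tp_C : Π^tp_X ∩ Π^tp_Ċ] = 4`, the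
`(ℤ/2ℤ)²` of Def. 2.5 (ii) / Def. 1.7). [cite: MochizukiEtTh2009, Def 2.5 (ii) p.39] -/
theorem index_inf_eq_four_of_index_two {X D : Subgroup G} (hX : X.index = 2) (hD : D.index = 2)
    (hne : D ≠ X) : (X ⊓ D).index = 4 := by
  haveI : D.Normal := Subgroup.normal_of_index_eq_two hD
  have h1 := Subgroup.relIndex_mul_index (inf_le_left : X ⊓ D ≤ X)
  rw [Subgroup.inf_relIndex_left, hX] at h1
  have hdvd : D.relIndex X ∣ 2 := hD ▸ Subgroup.relIndex_dvd_index_of_normal D X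
  rcases (Nat.dvd_prime Nat.prime_two).mp hdvd with h | h
  · exfalso
    apply hne
    have hXD : X ≤ D := Subgroup.relIndex_eq_one.mp h
    have h2 := Subgroup.relIndex_mul_index hXD
    rw [hD, hX] at h2
    have h3 : X.relIndex D = 1 := by omega
    exact le_antisymm (Subgroup.relIndex_eq_one.mp h3) hXD
  · rw [← h1, h]

/-- A subgroup `A` of ODD index meets an index-`2` subgroup `D` in a subgroup NOT contained in a second
index-`2` subgroup `X ≠ D` (else `4·[G:A]` would divide `[G : A ∩ D] ≤ 2·[G:A]`) — the group theory of
«`Ż → Z` is a genuine double covering not over `X`» for the odd-index members `C̲`, `C̲̲` (Def. 2.5 (ii)).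
[cite: MochizukiEtTh2009, Def 2.5 (ii) p.39] -/
theorem inf_not_le_of_odd_index {A X D : Subgroup G} (hA : Odd A.index) (hX : X.index = 2)
    (hD : D.index = 2) (hne : D ≠ X) : ¬ A ⊓ D ≤ X := by
  intro h
  have h4 := index_inf_eq_four_of_index_two hX hD hne
  have hA0 : A.index ≠ 0 := by obtain ⟨m, hm⟩ := hA; omega
  have hD0 : D.index ≠ 0 := by rw [hD]; decide
  have hV1 : A.index ∣ (A ⊓ D).index := Subgroup.index_dvd_of_le inf_le_left
  have hV2 : (X ⊓ D).index ∣ (A ⊓ D).index := Subgroup.index_dvd_of_le (le_inf h inf_le_right)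
  rw [h4] at hV2
  have hcop : Nat.Coprime 4 A.index := by
    have h2 : Nat.Coprime 2 A.index := Nat.coprime_two_left.mpr hA
    have : (4 : ℕ) = 2 ^ 2 := by norm_num
    rw [this]
    exact h2.pow_left 2
  have hmul : 4 * A.index ∣ (A ⊓ D).index := Nat.Coprime.mul_dvd_of_dvd_of_dvd hcop hV2 hV1
  have hle : (A ⊓ D).index ≤ A.index * D.index := Subgroup.index_inf_le
  rw [hD] at hle
  have hne0 : (A ⊓ D).index ≠ 0 := Subgroup.index_inf_ne_zero hA0 hD0
  have hle' := Nat.le_of_dvd (Nat.pos_of_ne_zero hne0) hmul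
  omega

/-- An intermediate subgroup `K ≤ B ≤ A` with `[A : K] = 2` is `K` or `A`: if `B ⊄ K` then `B = A` (maximality of
`Π^tp_{X̲}` in `Π^tp_{C̲}`, `[Π_{C̲} : Π_{X̲}] = 2`, Def. 2.1). [cite: MochizukiEtTh2009, Def 2.1 p.36] -/
theorem eq_of_relIndex_two_of_not_le {K B A : Subgroup G} (hK2 : K.relIndex A = 2) (hKB : K ≤ B)
    (hBA : B ≤ A) (hne : ¬ B ≤ K) : B = A := by
  have hmul := Subgroup.relIndex_mul_relIndex K B A hKB hBA
  rw [hK2] at hmul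
  have hdvd : B.relIndex A ∣ 2 := Dvd.intro_left _ hmul
  rcases (Nat.dvd_prime Nat.prime_two).mp hdvd with h | h
  · exact le_antisymm hBA (Subgroup.relIndex_eq_one.mp h)
  · exfalso
    rw [h] at hmul
    have : K.relIndex B = 1 := by omega
    exact hne (Subgroup.relIndex_eq_one.mp this)

/-- **The odd-index mechanism.** `X`, `D` distinct of index `2`, `K ⊴ G` with `K ≤ X`, `K ≤ C` of relative
index `2` in `C`, and `A ≤ C` of ODD index: then `(A ∩ D) ⊔ K = C`, so every element normalising `A ∩ D`
normalises `C`. (Used with `X = Π^tp_X`, `D = Π^tp_Ċ`, `K = Π^tp_{X̲}`, `C = Π^tp_{C̲}`, `A ∈ {Π^tp_{C̲}, Π^tp_{C̲̲}}`.)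
[cite: MochizukiEtTh2009, Rmk 2.6.1 p.40] -/
theorem mem_normalizer_of_mem_normalizer_inf_of_odd_index {A C K X D : Subgroup G} [K.Normal]
    (hX : X.index = 2) (hD : D.index = 2) (hne : D ≠ X) (hA : Odd A.index) (hAC : A ≤ C)
    (hKC : K ≤ C) (hKX : K ≤ X) (hK2 : K.relIndex C = 2) {g : G}
    (hg : g ∈ Subgroup.normalizer ((A ⊓ D : Subgroup G) : Set G)) :
    g ∈ Subgroup.normalizer (C : Set G) := by
  have hJ : (A ⊓ D) ⊔ K = C := by
    refine eq_of_relIndex_two_of_not_le hK2 le_sup_right (sup_le (inf_le_left.trans hAC) hKC) ?_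
    intro hle
    exact inf_not_le_of_odd_index hA hX hD hne ((le_sup_left.trans hle).trans hKX)
  rw [Subgroup.mem_normalizer_iff_map_conj_eq] at hg ⊢
  rw [← hJ, Subgroup.map_sup, hg, Subgroup.Normal.map_conj_eq K g]

/-- The intersection with an index-`2` normal subgroup `D` not containing `Z` has relative index `2` in `Z`
(`[Π^tp_Z : Π^tp_Ż] = 2`, Def. 2.5 (ii)). [cite: MochizukiEtTh2009, Def 2.5 (ii) p.39] -/
theorem relIndex_inf_eq_two_of_not_le {Z D : Subgroup G} [D.Normal] (hD : D.index = 2) (h : ¬ Z ≤ D) :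
    (Z ⊓ D).relIndex Z = 2 := by
  rw [Subgroup.inf_relIndex_left]
  have hdvd : D.relIndex Z ∣ 2 := hD ▸ Subgroup.relIndex_dvd_index_of_normal D Z
  rcases (Nat.dvd_prime Nat.prime_two).mp hdvd with h1 | h1
  · exact absurd (Subgroup.relIndex_eq_one.mp h1) h
  · exact h1

/-- **The odd-relative-index mechanism.** `U ⊴ G`, `Z ≤ U` with `U ≤ N(Z)` and `[U : Z]` ODD, `Z` of finite
index, `D ⊴ G` with `[Z : Z ∩ D] = 2`: every element normalising `Z ∩ D` normalises `Z` — the conjugate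
`g Z g⁻¹ ≤ U` contains `Z ∩ D`, so `[g Z g⁻¹ · Z : Z]` divides `2` and `[U : Z]`, hence is `1`. (Used with
`U = Π^tp_{X̲}`, `Z = Π^tp_{X̲̲}`, `D = Π^tp_Ċ`.) [cite: MochizukiEtTh2009, Rmk 2.6.1 p.40] -/
theorem mem_normalizer_of_mem_normalizer_inf_of_odd_relIndex {Z U D : Subgroup G} [U.Normal] [D.Normal]
    (hZU : Z ≤ U) (hUZ : U ≤ Subgroup.normalizer (Z : Set G)) (hodd : Odd (Z.relIndex U))
    (hZ0 : Z.index ≠ 0) (hZD : (Z ⊓ D).relIndex Z = 2) {g : G}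
    (hg : g ∈ Subgroup.normalizer ((Z ⊓ D : Subgroup G) : Set G)) :
    g ∈ Subgroup.normalizer (Z : Set G) := by
  rw [Subgroup.mem_normalizer_iff_map_conj_eq] at hg ⊢
  set H : Subgroup G := Z.map (MulAut.conj g) with hHdef
  -- `H ≤ U`
  have hHU : H ≤ U := by
    calc H ≤ U.map (MulAut.conj g) := Subgroup.map_mono hZU
      _ = U := Subgroup.Normal.map_conj_eq U g
  -- `Z ∩ D ≤ H`
  have hZDH : Z ⊓ D ≤ H := by
    calc Z ⊓ D = (Z ⊓ D).map (MulAut.conj g) := hg.symm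
      _ ≤ H := Subgroup.map_mono inf_le_left
  -- `[G : H] = [G : Z]`
  have hHi : H.index = Z.index := Subgroup.index_map_of_bijective (MulAut.conj g).bijective Z
  -- `[H : Z ∩ D] = 2`
  have hZDHi : (Z ⊓ D).relIndex H = 2 := by
    have h1 := Subgroup.relIndex_mul_index hZDH
    have h2 := Subgroup.relIndex_mul_index (inf_le_left : Z ⊓ D ≤ Z)
    rw [hZD] at h2
    rw [hHi, ← h2] at h1
    exact Nat.eq_of_mul_eq_mul_right (Nat.pos_of_ne_zero hZ0) h1
  -- `[H ⊔ Z : Z]` divides `[U : Z]` …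
  have hJU : H ⊔ Z ≤ U := sup_le hHU hZU
  have hdvd1 : Z.relIndex (H ⊔ Z) ∣ Z.relIndex U :=
    Dvd.intro _ (Subgroup.relIndex_mul_relIndex Z (H ⊔ Z) U le_sup_right hJU)
  -- … and divides `2` (inside `U`, where `Z` is normal, `[H ⊔ Z : Z] = [H : H ∩ Z]`, which divides `[H : Z ∩ D] = 2`)
  have hdvd2 : Z.relIndex (H ⊔ Z) ∣ 2 := by
    haveI : (Z.subgroupOf U).Normal := (Subgroup.normal_subgroupOf_iff_le_normalizer hZU).mpr hUZ
    have e1 : Z.relIndex (H ⊔ Z) = Z.relIndex H := by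
      rw [← Subgroup.relIndex_subgroupOf hJU, Subgroup.subgroupOf_sup hHU hZU,
        Subgroup.relIndex_sup_right (H.subgroupOf U) (Z.subgroupOf U), Subgroup.relIndex_subgroupOf hHU]
    rw [e1]
    have h3 := Subgroup.relIndex_dvd_of_le_left H (inf_le_left : Z ⊓ D ≤ Z)
    rwa [hZDHi] at h3
  have hone : Z.relIndex (H ⊔ Z) = 1 := by
    have h4 : Z.relIndex (H ⊔ Z) ∣ Nat.gcd (Z.relIndex U) 2 := Nat.dvd_gcd hdvd1 hdvd2
    rw [Nat.Coprime.gcd_eq_one (Nat.coprime_two_left.mpr hodd).symm] at h4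
    exact Nat.dvd_one.mp h4
  have hHZ : H ≤ Z := le_sup_left.trans (Subgroup.relIndex_eq_one.mp hone)
  refine le_antisymm hHZ ?_
  have h5 := Subgroup.relIndex_mul_index hHZ
  rw [hHi] at h5
  have h6 : H.relIndex Z = 1 := by
    have h7 : H.relIndex Z * Z.index = 1 * Z.index := by rw [h5, one_mul]
    exact Nat.eq_of_mul_eq_mul_right (Nat.pos_of_ne_zero hZ0) h7
  exact Subgroup.relIndex_eq_one.mp h6

end GroupTheory

/-! ## §2. The tempered tower: indices and the lattice identities -/

namespace TemperedCoverData

variable {l : ℕ} (T : TemperedCoverData.{u} l)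

/-- `[Π^tp_C : Π^tp_{C̲}] = l`. [cite: MochizukiEtTh2009, Rmk 2.3.1 p.38] -/
theorem index_tp_PiCu : (T.tp T.PiCu).index = l := by
  rw [T.index_tp T.isOpen_PiCu, T.index_PiCu]

/-- `[Π^tp_C : Π^tp_{C̲̲}] = l²`. [cite: MochizukiEtTh2009, Rmk 2.3.1 p.38] -/
theorem index_tp_PiCuu : (T.tp T.PiCuu).index = l * l := by
  rw [T.index_tp T.isOpen_PiCuu, T.index_PiCuu]

/-- `[Π^tp_C : Π^tp_{X̲}] = 2l`. [cite: MochizukiEtTh2009, Rmk 2.3.1 p.38] -/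
theorem index_tp_PiXu : (T.tp T.PiXu).index = l * 2 := by
  rw [T.index_tp T.isOpen_PiXu, T.index_PiXu]

/-- `[Π^tp_C : Π^tp_{X̲̲}] = 2l²`. [cite: MochizukiEtTh2009, Rmk 2.3.1 p.38] -/
theorem index_tp_PiXuu : (T.tp T.PiXuu).index = l * (l * 2) := by
  rw [T.index_tp T.isOpen_PiXuu, T.index_PiXuu]

/-- An odd number is nonzero. [folklore] -/
private theorem l_ne_zero_of_odd {n : ℕ} (hn : Odd n) : n ≠ 0 := by
  obtain ⟨m, hm⟩ := hn
  omega

/-- `Π^tp_{C̲} ∩ Π^tp_X = Π^tp_{X̲}`. [cite: MochizukiEtTh2009, Def 2.1 p.36] -/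
theorem tp_PiCu_inf_tp_PiX : T.tp T.PiCu ⊓ T.tp T.PiX = T.tp T.PiXu := by
  obtain ⟨H', E, S, ι, hH', hι, -, hE, hS, hdef⟩ := T.isTypeLTorsThetaPm.out
  rw [T.PiXu_eq_inf hH' hι hE hS hdef, T.PiCu_eq hH' hι hE hS hdef]
  exact (Subgroup.comap_inf _ _ _).symm

/-- `Π^tp_{C̲̲} ∩ Π^tp_X = Π^tp_{X̲̲}`. [cite: MochizukiEtTh2009, Def 2.3 p.38] -/
theorem tp_PiCuu_inf_tp_PiX : T.tp T.PiCuu ⊓ T.tp T.PiX = T.tp T.PiXuu :=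
  (Subgroup.comap_inf _ _ _).symm

/-- `Π^tp_{X̲} ≤ Π^tp_{C̲}`. [cite: MochizukiEtTh2009, Def 2.1 p.36] -/
theorem tp_PiXu_le_tp_PiCu : T.tp T.PiXu ≤ T.tp T.PiCu := by
  rw [← T.tp_PiCu_inf_tp_PiX]
  exact inf_le_left

/-- `Π^tp_{X̲̲} ≤ Π^tp_{X̲}`. [cite: MochizukiEtTh2009, Def 2.3 p.38] -/
theorem tp_PiXuu_le_tp_PiXu : T.tp T.PiXuu ≤ T.tp T.PiXu :=
  Subgroup.comap_mono (le_sup_left : T.PiXuu ≤ T.PiXu)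

/-- `[Π^tp_{C̲} : Π^tp_{X̲}] = 2`. [cite: MochizukiEtTh2009, Def 2.1 p.36] -/
theorem relIndex_tp_PiXu_tp_PiCu : (T.tp T.PiXu).relIndex (T.tp T.PiCu) = 2 := by
  have h := Subgroup.relIndex_mul_index T.tp_PiXu_le_tp_PiCu
  rw [T.index_tp_PiXu, T.index_tp_PiCu] at h
  have h' : (T.tp T.PiXu).relIndex (T.tp T.PiCu) * l = 2 * l := by rw [h, mul_comm]
  exact Nat.eq_of_mul_eq_mul_right (Nat.pos_of_ne_zero (l_ne_zero_of_odd T.l_odd)) h'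

/-- `[Π^tp_{X̲} : Π^tp_{X̲̲}] = l`. [cite: MochizukiEtTh2009, Rmk 2.3.1 p.38] -/
theorem relIndex_tp_PiXuu_tp_PiXu : (T.tp T.PiXuu).relIndex (T.tp T.PiXu) = l := by
  have h := Subgroup.relIndex_mul_index T.tp_PiXuu_le_tp_PiXu
  rw [T.index_tp_PiXuu, T.index_tp_PiXu] at h
  have hl2 : 0 < l * 2 := Nat.mul_pos (Nat.pos_of_ne_zero (l_ne_zero_of_odd T.l_odd)) two_pos
  exact Nat.eq_of_mul_eq_mul_right hl2 h

/-- `N_{Π^tp_C}(Π^tp_{C̲}) = Π^tp_{C̲}` (Rmk. 2.1.1, transferred by density). [cite: MochizukiEtTh2009, Rmk 2.1.1 p.36] -/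
theorem normalizer_tpPiCu_eq :
    Subgroup.normalizer ((T.tp T.PiCu : Subgroup T.Gtp) : Set T.Gtp) = T.tp T.PiCu := by
  rw [T.normalizer_tp_eq_of_isOpen T.isOpen_PiCu, T.normalizer_PiCu_eq]

/-- **`N_{Π^tp_C}(Π^tp_{X̲̲}) = Π^tp_{C̲}`** under `μ_l ⊆ K` and the printed definition `hΘ` of `Δ̄_Θ` (the rewriting
chain of abc-iut-L2-d3's `natCard_cuspOrbits_tpPiXuu`, stated on its own). [cite: MochizukiEtTh2009, Rmk 2.6.1 p.40] -/
theorem normalizer_tpPiXuu_eq (hΘ : ⁅T.DeltaX, T.DeltaX⁆ ⊔ T.barKer = T.barTheta) (hmu : T.HasMuL) :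
    Subgroup.normalizer ((T.tp T.PiXuu : Subgroup T.Gtp) : Set T.Gtp) = T.tp T.PiCu := by
  obtain ⟨H', E, S, ι, hH', hι, h2, hE, hS, hdef⟩ := T.isTypeLTorsThetaPm.out
  rw [T.normalizer_tp_eq_of_isOpen T.isOpen_PiXuu, T.PiXuu_eq_sup hH' hι h2 hE hS hdef,
    T.toCoverDataAx.normalizer_sup_eigen_eq hΘ hmu hH' hι h2 hE hS, T.PiCu_eq hH' hι hE hS hdef]

/-! ## §3. The dotted normalisers, member by member — no Prop. 2.6, no slimness -/

/-- **`N_{Π^tp_C}(Π^tp_{Ċ̲}) = N_{Π^tp_C}(Π^tp_{C̲})`** (`= Π^tp_{C̲}`), with NO hypothesis: `[Π^tp_C : Π^tp_{C̲}] = l` is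
odd, so `Π^tp_{Ċ̲} ⊔ Π^tp_{X̲} = Π^tp_{C̲}`. [cite: MochizukiEtTh2009, Rmk 2.6.1 p.40] -/
theorem normalizer_tpPiCu_inf_PiCdot_eq :
    Subgroup.normalizer ((T.tp T.PiCu ⊓ T.PiCdot : Subgroup T.Gtp) : Set T.Gtp) =
      Subgroup.normalizer ((T.tp T.PiCu : Subgroup T.Gtp) : Set T.Gtp) := by
  haveI hD : T.PiCdot.Normal := Subgroup.normal_of_index_eq_two T.index_PiCdot
  haveI hXu : (T.tp T.PiXu).Normal := T.tpPiXu_normal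
  refine le_antisymm (fun g hg => ?_) (normalizer_le_normalizer_inf (T.tp T.PiCu) T.PiCdot)
  have hodd : Odd (T.tp T.PiCu).index := by rw [T.index_tp_PiCu]; exact T.l_odd
  exact mem_normalizer_of_mem_normalizer_inf_of_odd_index T.index_tp_PiX T.index_PiCdot T.PiCdot_ne hodd
    le_rfl T.tp_PiXu_le_tp_PiCu (T.tp_PiCu_inf_tp_PiX ▸ inf_le_right) T.relIndex_tp_PiXu_tp_PiCu hg

/-- **`N_{Π^tp_C}(Π^tp_{Ċ̲̲}) = N_{Π^tp_C}(Π^tp_{C̲̲})`** (`= Π^tp_{C̲}`) under `μ_l ⊆ K` (`HasMuL`, through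
`N(Π^tp_{C̲̲}) = Π^tp_{C̲}`): `[Π^tp_C : Π^tp_{C̲̲}] = l²` is odd, so `Π^tp_{Ċ̲̲} ⊔ Π^tp_{X̲} = Π^tp_{C̲}`.
[cite: MochizukiEtTh2009, Rmk 2.6.1 p.40] -/
theorem normalizer_tpPiCuu_inf_PiCdot_eq (hmu : T.HasMuL) :
    Subgroup.normalizer ((T.tp T.PiCuu ⊓ T.PiCdot : Subgroup T.Gtp) : Set T.Gtp) =
      Subgroup.normalizer ((T.tp T.PiCuu : Subgroup T.Gtp) : Set T.Gtp) := by
  haveI hD : T.PiCdot.Normal := Subgroup.normal_of_index_eq_two T.index_PiCdot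
  haveI hXu : (T.tp T.PiXu).Normal := T.tpPiXu_normal
  refine le_antisymm (fun g hg => ?_) (normalizer_le_normalizer_inf (T.tp T.PiCuu) T.PiCdot)
  have hodd : Odd (T.tp T.PiCuu).index := by rw [T.index_tp_PiCuu]; exact T.l_odd.mul T.l_odd
  rw [T.normalizer_tpPiCuu_eq hmu, ← T.normalizer_tpPiCu_eq]
  exact mem_normalizer_of_mem_normalizer_inf_of_odd_index T.index_tp_PiX T.index_PiCdot T.PiCdot_ne hodd
    (Subgroup.comap_mono (le_sup_left : T.PiCuu ≤ T.PiCu)) T.tp_PiXu_le_tp_PiCu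
    (T.tp_PiCu_inf_tp_PiX ▸ inf_le_right)
    T.relIndex_tp_PiXu_tp_PiCu hg

/-- **`N_{Π^tp_C}(Π^tp_{Ẋ̲}) = N_{Π^tp_C}(Π^tp_{X̲})`** (`= Π^tp_C`), with NO hypothesis: both are normal.
[cite: MochizukiEtTh2009, Rmk 2.6.1 p.40] -/
theorem normalizer_tpPiXu_inf_PiCdot_eq :
    Subgroup.normalizer ((T.tp T.PiXu ⊓ T.PiCdot : Subgroup T.Gtp) : Set T.Gtp) =
      Subgroup.normalizer ((T.tp T.PiXu : Subgroup T.Gtp) : Set T.Gtp) := by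
  haveI hD : T.PiCdot.Normal := Subgroup.normal_of_index_eq_two T.index_PiCdot
  haveI hXu : (T.tp T.PiXu).Normal := T.tpPiXu_normal
  haveI : (T.tp T.PiXu ⊓ T.PiCdot).Normal := inferInstance
  rw [Subgroup.normalizer_eq_top, Subgroup.normalizer_eq_top]

/-- **`N_{Π^tp_C}(Π^tp_{Ẋ̲̲}) = N_{Π^tp_C}(Π^tp_{X̲̲})`** (`= Π^tp_{C̲}`) under `μ_l ⊆ K` and the printed definition `hΘ`
of `Δ̄_Θ` (through `N(Π^tp_{X̲̲}) = Π^tp_{C̲}`, so that `Π^tp_{X̲̲} ⊴ Π^tp_{X̲}`): `[Π^tp_{X̲} : Π^tp_{X̲̲}] = l` is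
odd. [cite: MochizukiEtTh2009, Rmk 2.6.1 p.40] -/
theorem normalizer_tpPiXuu_inf_PiCdot_eq (hΘ : ⁅T.DeltaX, T.DeltaX⁆ ⊔ T.barKer = T.barTheta) (hmu : T.HasMuL) :
    Subgroup.normalizer ((T.tp T.PiXuu ⊓ T.PiCdot : Subgroup T.Gtp) : Set T.Gtp) =
      Subgroup.normalizer ((T.tp T.PiXuu : Subgroup T.Gtp) : Set T.Gtp) := by
  haveI hD : T.PiCdot.Normal := Subgroup.normal_of_index_eq_two T.index_PiCdot
  haveI hXu : (T.tp T.PiXu).Normal := T.tpPiXu_normal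
  refine le_antisymm (fun g hg => ?_) (normalizer_le_normalizer_inf (T.tp T.PiXuu) T.PiCdot)
  have hodd : Odd ((T.tp T.PiXuu).relIndex (T.tp T.PiXu)) := by
    rw [T.relIndex_tp_PiXuu_tp_PiXu]; exact T.l_odd
  have hZ0 : (T.tp T.PiXuu).index ≠ 0 := by
    rw [T.index_tp_PiXuu]
    exact Nat.mul_ne_zero (l_ne_zero_of_odd T.l_odd) (Nat.mul_ne_zero (l_ne_zero_of_odd T.l_odd) two_ne_zero)
  have hUZ : T.tp T.PiXu ≤ Subgroup.normalizer ((T.tp T.PiXuu : Subgroup T.Gtp) : Set T.Gtp) := by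
    rw [T.normalizer_tpPiXuu_eq hΘ hmu]
    exact T.tp_PiXu_le_tp_PiCu
  have hm : T.tp T.PiXuu ∈ [T.tp T.PiXuu, T.tp T.PiXu, T.tp T.PiCuu, T.tp T.PiCu] := by simp
  exact mem_normalizer_of_mem_normalizer_inf_of_odd_relIndex T.tp_PiXuu_le_tp_PiXu hUZ hodd hZ0
    (relIndex_inf_eq_two_of_not_le T.index_PiCdot (T.not_le_PiCdot_of_mem_four hm)) hg

/-- **`N_{Π^tp_C}(Π^tp_Z ∩ Π^tp_Ċ) = N_{Π^tp_C}(Π^tp_Z)`** for all four `Z ∈ {X̲̲, X̲, C̲̲, C̲}` — abc-iut-L2-d3's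
`normalizer_inf_PiCdot_eq` with its binders `h26 : T.Prop26` ([EtTh] Prop. 2.6, F-0610) and
`hslim : IsSlimGroup T.Gtp` REPLACED by the group theory above (`l` odd, `Π^tp_{X̲} ⊴ Π^tp_C`); the printed
definition `hΘ` of `Δ̄_Θ` and `μ_l ⊆ K` are used for the member `X̲̲` (and `μ_l ⊆ K` for `C̲̲`).
[cite: MochizukiEtTh2009, Rmk 2.6.1 p.40] -/
theorem normalizer_inf_PiCdot_eq_of_odd (hΘ : ⁅T.DeltaX, T.DeltaX⁆ ⊔ T.barKer = T.barTheta) (hmu : T.HasMuL)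
    {Z : Subgroup T.Gtp} (hZ : Z ∈ [T.tp T.PiXuu, T.tp T.PiXu, T.tp T.PiCuu, T.tp T.PiCu]) :
    Subgroup.normalizer ((Z ⊓ T.PiCdot : Subgroup T.Gtp) : Set T.Gtp) =
      Subgroup.normalizer ((Z : Subgroup T.Gtp) : Set T.Gtp) := by
  simp only [List.mem_cons, List.not_mem_nil, or_false] at hZ
  rcases hZ with rfl | rfl | rfl | rfl
  · exact T.normalizer_tpPiXuu_inf_PiCdot_eq hΘ hmu
  · exact T.normalizer_tpPiXu_inf_PiCdot_eq
  · exact T.normalizer_tpPiCuu_inf_PiCdot_eq hmu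
  · exact T.normalizer_tpPiCu_inf_PiCdot_eq

/-! ## §4. Remark 2.6.1 (dotted) and Corollary 2.9 with Prop. 2.6 and slimness deleted -/

/-- **`Aut_K(Ż) ≅ Aut_K(Z) × Gal(Ċ/C)`** for `Z ∈ {X̲̲, X̲, C̲̲, C̲}` — abc-iut-L2-d3's `nonempty_autK_inf_PiCdot_mulEquiv`
without Prop. 2.6 / slimness. [cite: MochizukiEtTh2009, Rmk 2.6.1 p.40] -/
theorem nonempty_autK_inf_PiCdot_mulEquiv_of_odd (hΘ : ⁅T.DeltaX, T.DeltaX⁆ ⊔ T.barKer = T.barTheta)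
    (hmu : T.HasMuL) {Z : Subgroup T.Gtp}
    (hZ : Z ∈ [T.tp T.PiXuu, T.tp T.PiXu, T.tp T.PiCuu, T.tp T.PiCu]) :
    Nonempty (T.autK (Z ⊓ T.PiCdot) ≃* T.autK Z × Multiplicative (ZMod 2)) := by
  haveI hD : T.PiCdot.Normal := Subgroup.normal_of_index_eq_two T.index_PiCdot
  have hN := T.normalizer_inf_PiCdot_eq_of_odd hΘ hmu hZ
  set N := Subgroup.normalizer ((Z : Subgroup T.Gtp) : Set T.Gtp) with hNdef
  have hZN : Z ≤ N := Subgroup.le_normalizer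
  have hZDN : Z ⊓ T.PiCdot ≤ N := inf_le_left.trans hZN
  haveI : ((Z ⊓ T.PiCdot).subgroupOf N).Normal :=
    (Subgroup.normal_subgroupOf_iff_le_normalizer hZDN).mpr hN.ge
  obtain ⟨e1⟩ := nonempty_quotient_subgroupOf_congr (K := Z ⊓ T.PiCdot) hN
  obtain ⟨e2⟩ := nonempty_quotient_inf_mulEquiv_prod (N := N) T.index_PiCdot hZN
    (T.not_le_PiCdot_of_mem_four hZ)
  exact ⟨e1.trans e2⟩

/-- **Remark 2.6.1 for the once-dotted curves WITHOUT Prop. 2.6 and WITHOUT temp-slimness** — abc-iut-L2-t2's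
typed node `T.Rmk261_dotted` (`Aut_K(Ẋ̲̲) ≅ (μ_l × {±1}) × {±1}`, `Aut_K(Ẋ̲) ≅ (ℤ/lℤ ⋊ {±1}) × {±1}`,
`Aut_K(Ċ̲̲) ≅ μ_l × {±1}`, `Aut_K(Ċ̲) ≅ {±1}` under `μ_l ⊆ K`), from the printed definition `hΘ` of `Δ̄_Θ` alone
(abc-iut-L2-d3's `rmk261_dotted_of` had, in addition, `hslim` and `h26`). [cite: MochizukiEtTh2009, Rmk 2.6.1 p.40] -/
theorem rmk261_dotted_of_odd [NeZero l] (hΘ : ⁅T.DeltaX, T.DeltaX⁆ ⊔ T.barKer = T.barTheta) :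
    T.Rmk261_dotted := by
  intro hmu
  obtain ⟨hXuu, hXu, hCuu, hCu⟩ := T.rmk261_of hΘ hmu
  have m1 : T.tp T.PiXuu ∈ [T.tp T.PiXuu, T.tp T.PiXu, T.tp T.PiCuu, T.tp T.PiCu] := by simp
  have m2 : T.tp T.PiXu ∈ [T.tp T.PiXuu, T.tp T.PiXu, T.tp T.PiCuu, T.tp T.PiCu] := by simp
  have m3 : T.tp T.PiCuu ∈ [T.tp T.PiXuu, T.tp T.PiXu, T.tp T.PiCuu, T.tp T.PiCu] := by simp
  have m4 : T.tp T.PiCu ∈ [T.tp T.PiXuu, T.tp T.PiXu, T.tp T.PiCuu, T.tp T.PiCu] := by simp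
  obtain ⟨e1⟩ := T.nonempty_autK_inf_PiCdot_mulEquiv_of_odd hΘ hmu m1
  obtain ⟨e2⟩ := T.nonempty_autK_inf_PiCdot_mulEquiv_of_odd hΘ hmu m2
  obtain ⟨e3⟩ := T.nonempty_autK_inf_PiCdot_mulEquiv_of_odd hΘ hmu m3
  obtain ⟨e4⟩ := T.nonempty_autK_inf_PiCdot_mulEquiv_of_odd hΘ hmu m4
  obtain ⟨f1⟩ := hXuu
  obtain ⟨f2⟩ := hXu
  obtain ⟨f3⟩ := hCuu
  haveI : Unique (T.autK (T.tp T.PiCu)) := @uniqueOfSubsingleton _ hCu 1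
  exact ⟨⟨e1.trans (MulEquiv.prodCongr f1 (MulEquiv.refl _))⟩,
    ⟨e2.trans (MulEquiv.prodCongr f2 (MulEquiv.refl _))⟩,
    ⟨e3.trans (MulEquiv.prodCongr f3 (MulEquiv.refl _))⟩,
    ⟨e4.trans MulEquiv.uniqueProd⟩⟩

/-- The `Aut_K`-orbit spaces of cusps of `Ż` and of `Z` COINCIDE (`Z ∈ {X̲̲, X̲, C̲̲, C̲}`), without Prop. 2.6 /
slimness. [cite: MochizukiEtTh2009, Cor 2.9 p.43] -/
theorem natCard_cuspOrbits_inf_PiCdot_of_odd (hΘ : ⁅T.DeltaX, T.DeltaX⁆ ⊔ T.barKer = T.barTheta)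
    (hmu : T.HasMuL) {Z : Subgroup T.Gtp}
    (hZ : Z ∈ [T.tp T.PiXuu, T.tp T.PiXu, T.tp T.PiCuu, T.tp T.PiCu]) :
    Nat.card (T.cuspOrbits (Z ⊓ T.PiCdot)) = Nat.card (T.cuspOrbits Z) := by
  unfold cuspOrbits
  rw [T.normalizer_inf_PiCdot_eq_of_odd hΘ hmu hZ]

/-- **Corollary 2.9 for ALL SIX members `Ẋ̲̲, Ċ̲, Ċ̲̲, X̲̲, C̲, C̲̲` WITHOUT Prop. 2.6 and WITHOUT temp-slimness** —
abc-iut-L2-t2's typed node `T.Cor29_card` (`#(Aut_K(−)-orbits of cusps) = #(ℤ/lℤ)^± = (l+1)/2` under `μ_l ⊆ K`),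
from the printed definition `hΘ` of `Δ̄_Θ` and the cusp hypotheses `hC1`, `hC2` of `Sec2CuspOrbits` only
(abc-iut-L2-d3's `cor29_card_of` had, in addition, `hslim : IsSlimGroup T.Gtp` and `h26 : T.Prop26` = FACT
row F-0610). [cite: MochizukiEtTh2009, Cor 2.9 p.43] -/
theorem cor29_card_of_odd (hΘ : ⁅T.DeltaX, T.DeltaX⁆ ⊔ T.barKer = T.barTheta)
    (hC1 : T.cuspStabC ⊓ T.tp T.PiX ≤ T.tp T.PiXu) (hC2 : ¬ T.cuspStabC ≤ T.tp T.PiX) :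
    T.Cor29_card := by
  intro hmu S hS
  have hund := T.cor29_card_undotted_of hΘ hC1 hC2 hmu
  have m1 : T.tp T.PiXuu ∈ [T.tp T.PiXuu, T.tp T.PiXu, T.tp T.PiCuu, T.tp T.PiCu] := by simp
  have m3 : T.tp T.PiCuu ∈ [T.tp T.PiXuu, T.tp T.PiXu, T.tp T.PiCuu, T.tp T.PiCu] := by simp
  have m4 : T.tp T.PiCu ∈ [T.tp T.PiXuu, T.tp T.PiXu, T.tp T.PiCuu, T.tp T.PiCu] := by simp
  simp only [List.mem_cons, List.not_mem_nil, or_false] at hS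
  rcases hS with rfl | rfl | rfl | rfl | rfl | rfl
  · rw [T.natCard_cuspOrbits_inf_PiCdot_of_odd hΘ hmu m1]; exact hund _ (by simp)
  · rw [T.natCard_cuspOrbits_inf_PiCdot_of_odd hΘ hmu m4]; exact hund _ (by simp)
  · rw [T.natCard_cuspOrbits_inf_PiCdot_of_odd hΘ hmu m3]; exact hund _ (by simp)
  · exact hund _ (by simp)
  · exact hund _ (by simp)
  · exact hund _ (by simp)

/-- **The K-move in one line**: abc-iut-L2-d3's `cor29_card_of`, whose binders `hslim` / `h26` are now IDLE —
any values may be passed (here: the conclusion does not depend on them). [cite: MochizukiEtTh2009, Cor 2.9 p.43] -/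
theorem cor29_card_of_eq_cor29_card_of_odd (hΘ : ⁅T.DeltaX, T.DeltaX⁆ ⊔ T.barKer = T.barTheta)
    (hC1 : T.cuspStabC ⊓ T.tp T.PiX ≤ T.tp T.PiXu) (hC2 : ¬ T.cuspStabC ≤ T.tp T.PiX) :
    (T.Prop26 → T.Cor29_card) ∧ T.Cor29_card :=
  ⟨fun _ => T.cor29_card_of_odd hΘ hC1 hC2, T.cor29_card_of_odd hΘ hC1 hC2⟩

end TemperedCoverData

end ThetaCovers

end Literature.AnabelianGeometry.EtaleTheta
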